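import Literature.NumberTheory.EllipticCurves.NeronModelExistenceProofs
import Literature.NumberTheory.EllipticCurves.NeronModelAbelianSchemeProofs
import Literature.NumberTheory.DiophantineGeometry.AbelianSchemeModelSpecialFibre
import Literature.AlgebraicGeometry.Motives.AbelianVarietyGoodReductionFrobenius
import Literature.AlgebraicGeometry.Limits.RelativeDimensionDescent
import HarnessLib

/-!
# Good-reduction data of an abelian variety over a number field exist at all but finitely many places

Topic `Literature/AlgebraicGeometry/Motives`; namespace `Literature.AlgebraicGeometry.Motives`, grouping
sub-namespace `AbelianVariety` (the object).  THEOREMS ONLY (no definition, no named fact, no instance; net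
Literature debt 0).  Cell `hodgecm-mathlib` (D-0151), row II-1 / antecedent `FactGR` of the `S7a` composition of the
main theorem of complex multiplication ([Shimura1998] §18.6), COFINITE edition.

Let `K` be a number field, `A` an abelian variety over `K` (`Motives.AbelianVariety K`), `v` a finite place.  The tree's
**good-reduction datum** `A.GoodReductionAt v` (`Motives/AbelianVarietyGoodReductionFrobenius`: a smooth proper model of the
scheme `A.X` over `𝓞_{K,v}`, the reduction `Ā` as an ABELIAN VARIETY over `κ(v)` identified with the special fibre,
`dim Ā = dim A`, the extension of `K`-endomorphisms to the model and the reduction of endomorphisms `End A →+* End Ā`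
pinned to the special fibre of the extension — [BombieriGubler2006] 10.3.9, [Shimura1998] §11.1 Prop. 12,
[Milne1986AbelianVarieties] §20) was so far only available through the named fact `AbelianVariety.nonempty_goodReductionAt`.
This file PROVES that such data exist at every place outside a finite set — the form in which the datum is consumed (a
prime of good reduction is chosen by Chebotarev OUTSIDE any prescribed finite set):

* `exists_finite_forall_exists_isAbelianSchemeModel` — for all `v` outside a finite set, `A` is the generic fibre AS A
  GROUP SCHEME of a proper `𝓞_{K,v}`-group scheme smooth of relative dimension `dim A` (the tree's
  `DiophantineGeometry.IsAbelianSchemeModel A v 𝒜`; [SerreTate1968GoodReduction] §1): spread `A` out to a proper smooth group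
  scheme over a localisation `𝓞_K[1/f]` (`exists_abelianScheme_away_holds`, [Milne1986AbelianVarieties] Rem. 20.9, PROVED in
  the tree), base change to `𝓞_{K,v}` for `v ∌ f` (`exists_iso_pullback_pullback`), and read the relative dimension off the
  schematically dense generic fibre (`Limits.smoothOfRelativeDimension_of_isPullback_of_denseRange`).
* `isMonHom_of_isMonHom_genericFibre_map` — the generic fibre REFLECTS homomorphisms of flat separated group schemes
  over a domain (restriction to the schematically dense generic fibre is injective on morphisms from the flat `𝒜 ×_R 𝒜`
  and `Spec R` to the separated `𝒜`: `map_genericFibre_injective`, [Artin1986NeronModels] (1.1); [GortzWedhorn2020] 9.19).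
* `exists_goodReductionAt_of_isAbelianSchemeModel` — an abelian-scheme model YIELDS a good-reduction datum, with model
  the given group scheme and reduction its special fibre (`IsAbelianSchemeModel.specialFibre`, an abelian variety over
  `κ(v)` by Zariski's connectedness theorem, in the tree): the extension of endomorphisms is the NÉRON MAPPING PROPERTY of
  the proper smooth group scheme over the discrete valuation ring `𝓞_{K,v}` (`isNeronModel_of_isProper_of_smooth`,
  [BLRNeronModels1990] 1.2/8, [Artin1986NeronModels] Cor. (1.4), PROVED in the tree with Weil's extension theorem) at the
  smooth source `𝒜`; every extension is a homomorphism (previous bullet); the reduction of endomorphisms is the special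
  fibre of the extension (cartesian-monoidal base change of group-scheme homomorphisms), a ring homomorphism by the
  uniqueness half of the Néron property and `Functor.map_mul`; `dim Ā = dim A` by smoothness of relative dimension `dim A`.
* `exists_finite_forall_nonempty_goodReductionAt` — ★ for all `v` outside a finite set, `Nonempty (A.GoodReductionAt v)`;
  `exists_finite_forall_forall_nonempty_goodReductionAt` — the same simultaneously for a finite family.

NOT here (they stay as typed): the ∀-place form `nonempty_goodReductionAt` (a datum from an ARBITRARY smooth proper model
of the bare scheme at a PRESCRIBED place needs the extension of the group law to that model, Weil's theorem on
birational group laws [BLRNeronModels1990] §5.1, which spreading out cannot supply over a discrete valuation ring); the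
`ℓ`-adic datum `nonempty_tateSpecialisation`; the converse Néron–Ogg–Šafarevič criterion; `HomReduction.nonempty_homReduction`
for two ARBITRARY data (`GoodReductionAt` forgets the group law of the model; for data PRODUCED here the same Néron argument
applies).  HC_CM is proved only modulo the 7 printed citations until rung 0 closes.

## References

* [SerreTate1968GoodReduction] J.-P. Serre, J. Tate, *Good reduction of abelian varieties*, Ann. of Math. 88 (1968), §1.
* [BombieriGubler2006] E. Bombieri, W. Gubler, *Heights in Diophantine Geometry* (2006), 10.3.9 (p. 334).
* [Shimura1998] G. Shimura, *Abelian Varieties with Complex Multiplication and Modular Functions* (1998), §11.1, Prop. 12.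
* [Milne1986AbelianVarieties] J. S. Milne, *Abelian Varieties* (1986), §20, Rem. 20.9.
* [BLRNeronModels1990] S. Bosch, W. Lütkebohmert, M. Raynaud, *Néron Models* (1990), Prop. 1.2/8, Thm. 1.4/3, §5.1.
* [Artin1986NeronModels] M. Artin, *Néron Models*, in Cornell–Silverman (1986), (1.1), Cor. (1.4).
* [GortzWedhorn2020] U. Görtz, T. Wedhorn, *Algebraic Geometry I*, 2nd ed. (2020), Prop. 9.19, Lemma 14.6.
-/

set_option autoImplicit false

noncomputable section

open CategoryTheory CategoryTheory.Limits AlgebraicGeometry IsDedekindDomain IsDedekindDomain.HeightOneSpectrum MonoidalCategory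
open scoped MonObj NumberField CategoryTheory.Obj
open Literature.NumberTheory.EllipticCurves (genericFibre specGenericPoint IsNeronModel specOfAlgebraMap
  exists_abelianScheme_away_holds exists_iso_pullback_pullback specGenericPoint_comp_specOfAlgebraMap
  isSchemeTheoreticallyDominant_pullback_fst_specGenericPoint map_genericFibre_injective
  isNeronModel_of_isProper_of_smooth)
open Literature.NumberTheory.DiophantineGeometry (IsAbelianSchemeModel specialFibreFunctor)

namespace Literature.AlgebraicGeometry.Motives

namespace AbelianVariety

/-! ### The generic fibre reflects homomorphisms of group schemes -/

section Reflect

universe u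

variable {R : Type u} [CommRing R]

/-- The fibre product `𝒜 ×_R ℬ → Spec R` of two flat `R`-schemes (the monoidal product in `Over (Spec R)`,
whose structure map is `pr₁ ≫ (𝒜 → Spec R)`, Mathlib `Over.tensorObj_hom`) is flat: base change and composition
of flat morphisms. [folklore] -/
private theorem flat_tensorObj_hom (𝒜 ℬ : Over (Spec (.of R))) [Flat 𝒜.hom] [Flat ℬ.hom] : Flat (𝒜 ⊗ ℬ).hom := by
  rw [Over.tensorObj_hom]
  exact MorphismProperty.comp_mem _ _ _ (MorphismProperty.pullback_fst _ _ ‹_›) ‹_›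

/-- **The generic fibre reflects homomorphisms.**  Let `R` be a ring with field of fractions `K` and
`𝒜 → Spec R` a flat separated `R`-group scheme.  If the generic fibre `g_K : 𝒜_K → 𝒜_K` of an `R`-endomorphism
`g : 𝒜 → 𝒜` is a homomorphism of `K`-group schemes (for the group structure induced by the cartesian-monoidal
generic-fibre functor `genericFibre R K = Over.pullback (Spec K → Spec R)`), then `g` is a homomorphism of
`R`-group schemes: the two identities `η ≫ g = η` and `μ ≫ g = (g ⊗ g) ≫ μ` hold after restriction to the generic
fibre (unfold the induced unit and multiplication, Mathlib `Functor.obj.η_def` / `Functor.obj.μ_def`, and cancel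
the invertible coherence morphisms), and restriction to the generic fibre is injective on morphisms from the FLAT
`R`-schemes `Spec R` and `𝒜 ×_R 𝒜` to the SEPARATED `𝒜` (`map_genericFibre_injective`: the generic fibre of a flat
`R`-scheme is schematically dense, [GortzWedhorn2020] Lemma 14.6 and Prop. 9.19; the uniqueness half of the Néron
mapping property, [Artin1986NeronModels] (1.1)). [cite: Artin1986NeronModels, §1 (1.1) (uniqueness of extensions)]
[cite: GortzWedhorn2020, Prop. 9.19 and Lemma 14.6] -/
theorem isMonHom_of_isMonHom_genericFibre_map (K : Type u) [Field K] [Algebra R K] [IsFractionRing R K]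
    (𝒜 : Over (Spec (.of R))) [GrpObj 𝒜] [IsSeparated 𝒜.hom] [Flat 𝒜.hom] (g : 𝒜 ⟶ 𝒜)
    [hg : IsMonHom ((genericFibre R K).map g)] : IsMonHom g where
  one_hom := by
    haveI : Flat (𝟙_ (Over (Spec (.of R)))).hom := by
      rw [Over.tensorUnit_hom]; exact MorphismProperty.id_mem _ _
    apply map_genericFibre_injective R K 𝒜 (𝟙_ (Over (Spec (.of R))))
    have h := hg.one_hom
    simp only [Functor.obj.η_def, Category.assoc] at h
    rw [cancel_epi] at h
    change (genericFibre R K).map (η[𝒜] ≫ g) = (genericFibre R K).map η[𝒜]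
    rw [CategoryTheory.Functor.map_comp]
    exact h
  mul_hom := by
    haveI : Flat (𝒜 ⊗ 𝒜).hom := flat_tensorObj_hom 𝒜 𝒜
    apply map_genericFibre_injective R K 𝒜 (𝒜 ⊗ 𝒜)
    have h := hg.mul_hom
    simp only [Functor.obj.μ_def, Category.assoc] at h
    rw [Functor.LaxMonoidal.μ_natural_assoc, cancel_epi] at h
    change (genericFibre R K).map (μ[𝒜] ≫ g) = (genericFibre R K).map ((g ⊗ₘ g) ≫ μ[𝒜])
    rw [CategoryTheory.Functor.map_comp, CategoryTheory.Functor.map_comp]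
    exact h

end Reflect

variable {K : Type} [Field K] [NumberField K]

/-! ### From an abelian-scheme model at `v` to the good-reduction datum at `v` -/

section Model

variable {A : AbelianVariety K} {v : HeightOneSpectrum (𝓞 K)}
  {𝒜 : SchemeOver (valuationSubringAtPrime K v)} [GrpObj 𝒜]

/-- **An abelian-scheme model is the Néron model of its generic fibre**: for an abelian-scheme model `𝒜` of `A`
at `v` (`IsAbelianSchemeModel A v 𝒜`: proper, smooth of relative dimension `dim A`, generic fibre `≅ A` as a group
scheme) the proper smooth `𝓞_{K,v}`-group scheme `𝒜` has the Néron mapping property over the discrete valuation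
ring `𝓞_{K,v}` (the tree's PROVED `isNeronModel_of_isProper_of_smooth`, [BLRNeronModels1990] Prop. 1.2/8;
[Artin1986NeronModels] Cor. (1.4): "an abelian scheme over `R` is the Néron model of its generic fibre").
[cite: BLRNeronModels1990, Prop. 1.2/8] [cite: Artin1986NeronModels, Cor. (1.4) (p. 215)] -/
theorem isNeronModel_of_isAbelianSchemeModel (h : IsAbelianSchemeModel A v 𝒜) :
    IsNeronModel (valuationSubringAtPrime K v) K 𝒜 ((genericFibre (valuationSubringAtPrime K v) K).obj 𝒜) := by
  haveI := h.isProper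
  haveI := h.smooth
  haveI : Smooth 𝒜.hom := SmoothOfRelativeDimension.smooth A.dim 𝒜.hom
  exact isNeronModel_of_isProper_of_smooth _ K 𝒜

/-- **`dim Ā = dim A`**: the special fibre `Ā = 𝒜 ×_{𝓞_{K,v}} κ(v)` of an abelian-scheme model of `A`
(`IsAbelianSchemeModel.specialFibre`, an abelian variety over `κ(v)`) has the dimension of `A` — it is non-empty
and smooth over `κ(v)` of relative dimension `dim A` (base change), and the dimension of a non-empty scheme smooth
of relative dimension `n` over a field is `n` (`schemeDim_eq_of_smoothOfRelativeDimension`).  [Shimura1998] §11.1: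
"`Ã` is an abelian variety of the same dimension as `A`". [cite: Shimura1998, §11.1 (reduction modulo 𝔭; held chunk p0109 L1)] -/
theorem dim_specialFibre_of_isAbelianSchemeModel (h : IsAbelianSchemeModel A v 𝒜) : h.specialFibre.dim = A.dim := by
  haveI := h.smooth
  haveI := smoothOfRelativeDimension_isStableUnderBaseChange (n := A.dim)
  haveI : SmoothOfRelativeDimension A.dim h.specialFibre.X.hom := MorphismProperty.baseChange_obj _ _ ‹_›
  haveI : Nonempty h.specialFibre.X.left := inferInstance
  exact schemeDim_eq_of_smoothOfRelativeDimension h.specialFibre.X.hom A.dim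

/-- **An abelian-scheme model of `A` at `v` yields a good-reduction datum of `A` at `v`** whose model is the given group
scheme `𝒜` and whose reduction is the special fibre `Ā = 𝒜 ×_{𝓞_{K,v}} κ(v)` with its base-changed group structure
(`IsAbelianSchemeModel.specialFibre`, an abelian variety over `κ(v)`; [SerreTate1968GoodReduction] §1).  The nine fields of
`GoodReductionAt` ([BombieriGubler2006] 10.3.9; [Shimura1998] §11.1 Prop. 12; [Milne1986AbelianVarieties] §20): the model
`⟨𝒜, e⟩` with `e : 𝒜_K ≅ A` a chosen group-scheme isomorphism, smooth of relative dimension `dim A` and proper;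
`reductionIso = Iso.refl` (the special-fibre functor IS `IntegralModel.reductionAt`, definitionally); `dim Ā = dim A`;
**extension of endomorphisms** `liftEnd f` := the unique `𝓞_{K,v}`-endomorphism of `𝒜` with generic fibre `e ≫ f ≫ e⁻¹` —
the NÉRON MAPPING PROPERTY of `𝒜` (`isNeronModel_of_isAbelianSchemeModel`) at the smooth source `𝒜` ([BombieriGubler2006]
10.3.9: "a morphism `Y_K → A` over `K` … is a morphism") — each a HOMOMORPHISM of group schemes
(`isMonHom_of_isMonHom_genericFibre_map`), with `liftEnd 1 = 𝟙`, `liftEnd (f ∘ g) = liftEnd f ∘ liftEnd g`,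
`liftEnd (f + g) = liftEnd f · liftEnd g` by uniqueness (the generic-fibre functor is cartesian monoidal, `Functor.map_mul`);
**reduction of endomorphisms** `redEnd f := (liftEnd f) ×_{𝓞_{K,v}} κ(v)` as an endomorphism of `Ā` (the special-fibre functor
on group-scheme homomorphisms), a RING HOMOMORPHISM `End A →+* End Ā` ([Shimura1998] §11.1 Prop. 12: "`λ → λ̃` … If `A = B`,
this is a ring-injection"; injectivity is not part of the datum), the special fibre of `liftEnd f` by construction.
[cite: BombieriGubler2006, 10.3.9 (p. 334)] [cite: Shimura1998, §11.1 Prop. 12 (§11, pp. 83–87; held chunk p0109 L3)]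
[cite: Milne1986AbelianVarieties, §20 (abelian schemes) and Cor. 20.2] [cite: SerreTate1968GoodReduction, §1] -/
theorem exists_goodReductionAt_of_isAbelianSchemeModel (h : IsAbelianSchemeModel A v 𝒜) :
    ∃ R : A.GoodReductionAt v, R.model.total = 𝒜 ∧ R.reduction = h.specialFibre := by
  classical
  obtain ⟨e, he⟩ := h.exists_iso
  haveI := he
  have hN := isNeronModel_of_isAbelianSchemeModel h
  haveI := h.isProper
  haveI := h.smooth
  haveI : Smooth 𝒜.hom := SmoothOfRelativeDimension.smooth A.dim 𝒜.hom
  haveI : IsSeparated 𝒜.hom := hN.isSeparated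
  -- the Néron bijection `Hom_R(𝒜, 𝒜) ≃ Hom_K(𝒜_K, 𝒜_K)` at the smooth source `𝒜`
  have hbij := hN.mappingProperty 𝒜 ‹Smooth 𝒜.hom›
  let Φ : (𝒜 ⟶ 𝒜) ≃ ((genericFibre (valuationSubringAtPrime K v) K).obj 𝒜 ⟶
      (genericFibre (valuationSubringAtPrime K v) K).obj 𝒜) := Equiv.ofBijective _ hbij
  -- the extension of the `K`-endomorphisms of `A`, transported along `e`
  let L : End A → (𝒜 ⟶ 𝒜) := fun f => Φ.symm (e.hom ≫ f.hom.hom.hom ≫ e.inv)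
  have hL : ∀ f : End A, (genericFibre (valuationSubringAtPrime K v) K).map (L f) =
      e.hom ≫ f.hom.hom.hom ≫ e.inv := fun f => Φ.apply_symm_apply _
  have hinj : Function.Injective fun g : 𝒜 ⟶ 𝒜 => (genericFibre (valuationSubringAtPrime K v) K).map g :=
    hbij.1
  -- every extension is a homomorphism of group schemes
  have hLmon : ∀ f : End A, IsMonHom (L f) := fun f => by
    haveI : IsMonHom ((genericFibre (valuationSubringAtPrime K v) K).map (L f)) := by
      rw [hL]; infer_instance
    exact isMonHom_of_isMonHom_genericFibre_map K 𝒜 (L f)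
  -- the extension is unital, multiplicative (for composition) and additive (pointwise product), by uniqueness
  have hL1 : L 1 = 𝟙 𝒜 := hinj (by
    change (genericFibre _ K).map (L 1) = (genericFibre _ K).map (𝟙 𝒜)
    rw [hL, CategoryTheory.Functor.map_id, End.one_def, AbelianVariety.id_hom, Grp.id_hom_hom]
    simp)
  have hLmul : ∀ f g : End A, L (f * g) = L g ≫ L f := fun f g => hinj (by
    change (genericFibre _ K).map (L (f * g)) = (genericFibre _ K).map (L g ≫ L f)
    rw [CategoryTheory.Functor.map_comp, hL, hL, hL, End.mul_def, AbelianVariety.comp_hom, Grp.comp_hom_hom]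
    simp)
  have hLadd : ∀ f g : End A, L (f + g) = L f * L g := fun f g => hinj (by
    change (genericFibre _ K).map (L (f + g)) = (genericFibre _ K).map (L f * L g)
    rw [Functor.map_mul, hL, hL, hL]
    change e.hom ≫ (f.hom * g.hom).hom.hom ≫ e.inv = _
    rw [Grp.Hom.hom_mul, Mon.Hom.hom_mul, MonObj.mul_comp, MonObj.comp_mul])
  -- the reduction of endomorphisms: the special fibre of the extension, an endomorphism of `Ā`
  let r : End A → End h.specialFibre := fun f =>
    haveI := hLmon f
    InducedCategory.homMk ((specialFibreFunctor v).mapGrp.map (Grp.ofHom (L f)))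
  have hr : ∀ f, (r f).hom.hom.hom = (specialFibreFunctor v).map (L f) := fun f => rfl
  have hr1 : r 1 = 1 := by
    apply AbelianVariety.hom_ext
    rw [hr, hL1]
    change (specialFibreFunctor v).map (𝟙 𝒜) = 𝟙 ((specialFibreFunctor v).obj 𝒜)
    exact (specialFibreFunctor v).map_id _
  have hrmul : ∀ f g, r (f * g) = r f * r g := fun f g => by
    apply AbelianVariety.hom_ext
    rw [End.mul_def (r f) (r g), hr, hLmul, CategoryTheory.Functor.map_comp]
    rfl
  have hradd : ∀ f g, r (f + g) = r f + r g := fun f g => by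
    apply AbelianVariety.hom_ext
    rw [hr, hLadd]
    change (specialFibreFunctor v).map (L f * L g) =
      (specialFibreFunctor v).map (L f) * (specialFibreFunctor v).map (L g)
    exact Functor.map_mul (specialFibreFunctor v) (L f) (L g)
  let ρ : End A →+* End h.specialFibre :=
    RingHom.mk' { toFun := r, map_one' := hr1, map_mul' := hrmul } hradd
  refine ⟨{ model := ⟨𝒜, e⟩
            isSmoothProper := ⟨h.smooth, h.isProper⟩
            reduction := h.specialFibre
            reductionIso := Iso.refl _
            dim_reduction := dim_specialFibre_of_isAbelianSchemeModel h
            liftEnd := L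
            liftEnd_left_comp := fun f => ?_
            redEnd := ρ
            redEnd_left_comp := fun f => ?_ }, rfl, rfl⟩
  · -- the generic fibre of the extension is `e ≫ f ≫ e⁻¹`
    have h1 : (genericFibre (valuationSubringAtPrime K v) K).map (L f) ≫ e.hom = e.hom ≫ f.hom.hom.hom := by
      rw [hL]; simp
    have h2 := congrArg CommaMorphism.left h1
    simp only [Over.comp_left] at h2
    exact h2
  · -- the reduction is the special fibre of the extension (`reductionIso = Iso.refl`)
    change ((specialFibreFunctor v).map (L f)).left ≫ 𝟙 _ = 𝟙 _ ≫ ((specialFibreFunctor v).map (L f)).left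
    simp

/-- An abelian-scheme model of `A` at `v` gives a good-reduction datum of `A` at `v` (the `Nonempty` form of
`exists_goodReductionAt_of_isAbelianSchemeModel`; [SerreTate1968GoodReduction] §1, [BombieriGubler2006] 10.3.9).
[cite: BombieriGubler2006, 10.3.9 (p. 334)] [cite: SerreTate1968GoodReduction, §1] -/
theorem nonempty_goodReductionAt_of_isAbelianSchemeModel (h : IsAbelianSchemeModel A v 𝒜) :
    Nonempty (A.GoodReductionAt v) := by
  obtain ⟨R, -, -⟩ := exists_goodReductionAt_of_isAbelianSchemeModel h
  exact ⟨R⟩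

/-- An abelian-scheme model of `A` at `v` gives, in particular, the tree's named fact
`AbelianVariety.nonempty_goodReductionAt A v` AT THAT PLACE (its conclusion holds outright).
[cite: BombieriGubler2006, 10.3.9 (p. 334)] -/
theorem nonempty_goodReductionAt_holds_of_isAbelianSchemeModel (h : IsAbelianSchemeModel A v 𝒜) :
    A.nonempty_goodReductionAt v :=
  fun _ => nonempty_goodReductionAt_of_isAbelianSchemeModel h

end Model

/-! ### Good reduction at all but finitely many places -/

/-- The finite places of `K` containing a given non-zero integer `f ∈ 𝓞_K` form a finite set (the prime factors of
`(f)`, Mathlib `Ideal.finite_factors`). [folklore] -/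
private theorem finite_setOf_mem_asIdeal {f : 𝓞 K} (hf : f ≠ 0) :
    {v : HeightOneSpectrum (𝓞 K) | f ∈ v.asIdeal}.Finite := by
  refine (Ideal.finite_factors (I := Ideal.span {f}) ?_).subset fun v hv => ?_
  · rwa [Ne, Ideal.zero_eq_bot, Ideal.span_singleton_eq_bot]
  · change v.asIdeal ∣ Ideal.span {f}
    rw [Ideal.dvd_span_singleton]
    exact hv

/-- **The relative dimension of a smooth `𝓞_{K,v}`-model is read off on its generic fibre**: if `𝒜 → Spec 𝓞_{K,v}` is smooth
and `𝒜_K ≅ A.X` over `K`, then `𝒜 → Spec 𝓞_{K,v}` is smooth of relative dimension `dim A` — the generic fibre is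
(`AbelianVariety.smoothOfRelativeDimension_dim` transported along the isomorphism), it is schematically dense in the flat `𝒜`
(`isSchemeTheoreticallyDominant_pullback_fst_specGenericPoint`, [GortzWedhorn2020] Lemma 14.6), and the locally constant relative
dimension of a smooth morphism is then `dim A` everywhere (`Limits.smoothOfRelativeDimension_of_isPullback_of_denseRange`,
[Hartshorne1977] III 10.1 (b)). [cite: GortzWedhorn2020, Lemma 14.6] [cite: Hartshorne1977, Ch. III Prop. 10.1 (b)] -/
theorem smoothOfRelativeDimension_of_genericFibre_iso {v : HeightOneSpectrum (𝓞 K)}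
    (𝒜 : SchemeOver (valuationSubringAtPrime K v)) [Smooth 𝒜.hom] (A : AbelianVariety K)
    (e : (genericFibre (valuationSubringAtPrime K v) K).obj 𝒜 ≅ A.X) :
    SmoothOfRelativeDimension A.dim 𝒜.hom := by
  have H : IsPullback (pullback.fst 𝒜.hom (specGenericPoint (valuationSubringAtPrime K v) K))
      ((genericFibre (valuationSubringAtPrime K v) K).obj 𝒜).hom 𝒜.hom
      (specGenericPoint (valuationSubringAtPrime K v) K) :=
    IsPullback.of_hasPullback _ _
  -- the generic fibre is smooth of relative dimension `dim A` (transport along `e`)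
  have hgen : SmoothOfRelativeDimension A.dim ((genericFibre (valuationSubringAtPrime K v) K).obj 𝒜).hom := by
    have h1 := (MorphismProperty.cancel_left_of_respectsIso (@SmoothOfRelativeDimension A.dim)
      e.hom.left A.X.hom).mpr A.smoothOfRelativeDimension_dim
    rwa [Over.w e.hom] at h1
  -- the generic fibre is dense (`𝒜` is flat over the domain `𝓞_{K,v}`)
  haveI := isSchemeTheoreticallyDominant_pullback_fst_specGenericPoint (valuationSubringAtPrime K v) K 𝒜
  have hd : DenseRange (pullback.fst 𝒜.hom (specGenericPoint (valuationSubringAtPrime K v) K)).base :=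
    (pullback.fst 𝒜.hom (specGenericPoint (valuationSubringAtPrime K v) K)).denseRange
  exact Literature.AlgebraicGeometry.Limits.smoothOfRelativeDimension_of_isPullback_of_denseRange
    (hn := hgen) H A.dim hd

/-- **Good reduction at all but finitely many places, as an abelian-scheme model** ([SerreTate1968GoodReduction] §1;
[Shimura1998] §11.1 "for almost all `𝔭`"; [Milne1986AbelianVarieties] Rem. 20.9; [BombieriGubler2006] 10.3.9).  For an
abelian variety `A` over a number field `K` there is a finite set `S` of finite places such that for every `v ∉ S`
there is a proper `𝓞_{K,v}`-group scheme `𝒜`, smooth of relative dimension `dim A`, whose generic fibre is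
isomorphic to `A` AS A GROUP SCHEME over `K` (`IsAbelianSchemeModel A v 𝒜`).  Proof: `A` spreads out to a proper
smooth group scheme `𝒜₀` over `𝓞_K[1/f]` for some `f ≠ 0` with generic fibre `≅ A`
(`exists_abelianScheme_away_holds`); `S` := the finite set of places `v ∋ f` (`finite_setOf_mem_asIdeal`); for
`v ∌ f`, `f` is a unit of `𝓞_{K,v}`, so `𝓞_{K,v}` is an `𝓞_K[1/f]`-algebra inside `K` and `𝒜 := 𝒜₀ ×_{𝓞_K[1/f]}
𝓞_{K,v}` is a proper smooth `𝓞_{K,v}`-group scheme with generic fibre `(𝒜₀ ×_{𝓞_K[1/f]} 𝓞_{K,v})_K ≅ (𝒜₀)_K ≅ A`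
as group schemes (`exists_iso_pullback_pullback`); its relative dimension is `dim A`
(`smoothOfRelativeDimension_of_genericFibre_iso`). [cite: SerreTate1968GoodReduction, §1]
[cite: Milne1986AbelianVarieties, Rem. 20.9 (§20, p. 146)] [cite: BombieriGubler2006, 10.3.9 (p. 334)] -/
theorem exists_finite_forall_exists_isAbelianSchemeModel (A : AbelianVariety K) :
    ∃ S : Set (HeightOneSpectrum (𝓞 K)), S.Finite ∧ ∀ v ∉ S,
      ∃ (𝒜 : SchemeOver (valuationSubringAtPrime K v)) (_ : GrpObj 𝒜), IsAbelianSchemeModel A v 𝒜 := by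
  classical
  obtain ⟨f, hf0, hf⟩ := exists_abelianScheme_away_holds (𝓞 K) K A.X
  refine ⟨{v | f ∈ v.asIdeal}, finite_setOf_mem_asIdeal hf0, fun v hv => ?_⟩
  -- the localisation `𝓞_K[1/f]` inside `K`
  have hfK : IsUnit (algebraMap (𝓞 K) K f) := by
    rw [isUnit_iff_ne_zero, map_ne_zero_iff _ (IsFractionRing.injective (𝓞 K) K)]
    exact hf0
  letI : Algebra (Localization.Away f) K := (IsLocalization.Away.lift f hfK).toAlgebra
  haveI : IsScalarTower (𝓞 K) (Localization.Away f) K :=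
    IsScalarTower.of_algebraMap_eq fun r => (IsLocalization.Away.lift_eq f hfK r).symm
  obtain ⟨𝒜, hprop, hsm, e, he⟩ := hf (Localization.Away f)
  -- `𝓞_{K,v}` is an `𝓞_K[1/f]`-algebra inside `K` (`f` is a unit of `𝓞_{K,v}` since `f ∉ v`)
  have hfO : IsUnit (algebraMap (𝓞 K) (valuationSubringAtPrime K v) f) :=
    IsLocalization.map_units (M := v.asIdeal.primeCompl) (valuationSubringAtPrime K v) ⟨f, hv⟩
  letI : Algebra (Localization.Away f) (valuationSubringAtPrime K v) :=
    (IsLocalization.Away.lift f hfO).toAlgebra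
  haveI : IsScalarTower (𝓞 K) (Localization.Away f) (valuationSubringAtPrime K v) :=
    IsScalarTower.of_algebraMap_eq fun r => (IsLocalization.Away.lift_eq f hfO r).symm
  haveI : IsScalarTower (Localization.Away f) (valuationSubringAtPrime K v) K := by
    refine IsScalarTower.of_algebraMap_eq' ?_
    refine IsLocalization.ringHom_ext (Submonoid.powers f) ?_
    rw [RingHom.comp_assoc, ← IsScalarTower.algebraMap_eq (𝓞 K) (Localization.Away f) (valuationSubringAtPrime K v),
      ← IsScalarTower.algebraMap_eq, ← IsScalarTower.algebraMap_eq]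
  -- base change of the spread to `𝓞_{K,v}`
  let a := specOfAlgebraMap (Localization.Away f) (valuationSubringAtPrime K v)
  let 𝒜v : SchemeOver (valuationSubringAtPrime K v) := (Over.pullback a).obj 𝒜.X
  haveI : IsProper 𝒜.X.hom := hprop
  haveI : Smooth 𝒜.X.hom := hsm
  haveI : IsProper 𝒜v.hom := MorphismProperty.pullback_snd _ _ hprop
  haveI : Smooth 𝒜v.hom := MorphismProperty.pullback_snd _ _ hsm
  have hiso : ∃ e' : (genericFibre (valuationSubringAtPrime K v) K).obj 𝒜v ≅ A.X, IsMonHom e'.hom :=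
    exists_iso_pullback_pullback a (specGenericPoint (valuationSubringAtPrime K v) K) 𝒜.X A.X
      (specGenericPoint_comp_specOfAlgebraMap (Localization.Away f) K (valuationSubringAtPrime K v)) ⟨e, he⟩
  refine ⟨𝒜v, inferInstance, ?_, ‹_›, hiso⟩
  obtain ⟨e', -⟩ := hiso
  exact smoothOfRelativeDimension_of_genericFibre_iso 𝒜v A e'

/-- ★ **An abelian variety over a number field has good reduction — a good-reduction DATUM `GoodReductionAt` — at
all but finitely many finite places** ([Shimura1998] §11.1 with Prop. 12: reduction of `A` and of its endomorphisms
modulo `𝔭` "for almost all `𝔭`"; [BombieriGubler2006] 10.3.9; [SerreTate1968GoodReduction] §1).  This is the COFINITE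
edition of the tree's named fact `AbelianVariety.nonempty_goodReductionAt` and the form in which a prime of good
reduction is chosen (by Chebotarev, outside any finite set).  Composition of
`exists_finite_forall_exists_isAbelianSchemeModel` (spreading out + base change) and
`exists_goodReductionAt_of_isAbelianSchemeModel` (Néron mapping property + special fibre).
[cite: Shimura1998, §11.1 Prop. 12 (§11, pp. 83–87; held chunk p0109 L3)] [cite: BombieriGubler2006, 10.3.9 (p. 334)]
[cite: SerreTate1968GoodReduction, §1] -/
theorem exists_finite_forall_nonempty_goodReductionAt (A : AbelianVariety K) :
    ∃ S : Set (HeightOneSpectrum (𝓞 K)), S.Finite ∧ ∀ v ∉ S, Nonempty (A.GoodReductionAt v) := by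
  obtain ⟨S, hS, h⟩ := exists_finite_forall_exists_isAbelianSchemeModel A
  refine ⟨S, hS, fun v hv => ?_⟩
  obtain ⟨𝒜, _, h𝒜⟩ := h v hv
  exact nonempty_goodReductionAt_of_isAbelianSchemeModel h𝒜

/-- **Simultaneous good reduction of a finite family**: for finitely many abelian varieties `A i` over `K` there is
ONE finite set of finite places outside which every `A i` carries a good-reduction datum (union of the finitely
many exceptional sets of `exists_finite_forall_nonempty_goodReductionAt`).  This is the shape in which a common prime
of good reduction is chosen for a CM abelian variety, its class-representative companions and their conjugates
([Shimura1998] §18.6, proof of the main theorem). [cite: Shimura1998, §11.1 Prop. 12 and §18.6 (proof of Thm. 18.6, p. 164)] -/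
theorem exists_finite_forall_forall_nonempty_goodReductionAt {J : Type*} [Finite J]
    (A : J → AbelianVariety K) :
    ∃ S : Set (HeightOneSpectrum (𝓞 K)), S.Finite ∧ ∀ v ∉ S, ∀ i, Nonempty ((A i).GoodReductionAt v) := by
  choose S hS h using fun i => exists_finite_forall_nonempty_goodReductionAt (A i)
  refine ⟨⋃ i, S i, Set.finite_iUnion hS, fun v hv i => h i v fun hvi => hv ?_⟩
  exact Set.mem_iUnion.mpr ⟨i, hvi⟩

end AbelianVariety

end Literature.AlgebraicGeometry.Motives

end
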